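import Summits.AtomisticToContinuum.HydrodynamicLimit.Theorems.LambertianContactSwapLambertianEulerLawSemigroup
import HarnessLib

/-!
# Two-time law of the Lambertian gas (crux `LambertianEuler`, stmt-AtomisticToContinuum-11854, line `Sketch`, stub `stub_twoTimeLawLambda`)

The Lambertian (cosine-redraw) hard-sphere flow `Λ_t(z; ξs) = lambertFlow G ε ξs z t` of
`Literature.MathematicalPhysics.KineticTheory.LambertianHardSphereFlow` is driven by the i.i.d.
Gaussian noise `ξs ∼ γ^ℕ = lambertNoise`.  The registered stub `stub_twoTimeLawLambda` is the
**Markov property in law at a deterministic time**, in Tonelli (`lintegral`) form: on `𝕋³`, for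
`0 < ε < 1/2`, a finite initial law `P ≪ liouville`, `s, h ≥ 0` and a measurable `F ≥ 0` on pairs
of states,
`E_{P ⊗ γ^ℕ}[F(Λ_s, Λ_{s+h})] = E_{μ_s ⊗ γ^ℕ}[F(q, Λ_h(q; ηs))]`, `μ_s := (P ⊗ γ^ℕ) ∘ Λ_s⁻¹`,
i.e. the joint law of `(Λ_s, Λ_{s+h})` is the law of `(q, Λ_h(q; ηs))` with `q ∼ μ_s` and FRESH
noise `ηs ∼ γ^ℕ`.  It glues the kernel's restarted window expectation to the pathwise tools run
along one trajectory from time `0`.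

Proof route (verbatim the calc block of the landed one-time version
`…LambertianEulerLawSemigroup.map_lambertFlow_add_eq_map`, with the one-state observable
`f(Λ_{s+u})` replaced by the two-state observable `F(Λ_s, Λ_{s+h})`; first for an arbitrary
geometry and initial measure `L`, `lintegral_twoTime_eq`):
`∫ F(Λ_s, Λ_{s+h}) d(L ⊗ γ^ℕ) = ∫ dL(z) ∫ dγ^ℕ(ξs) F(Λ_s(z;ξs), Λ_{s+h}(z;ξs))` (`lintegral_prod`)
`= ∫ dL(z) ∫ dγ^ℕ(ξs) F(Λ_s(z;ξs), Λ_h(Λ_s(z;ξs); ξs (· + K_s)))` (pathwise cocycle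
`lambertFlow_add_eq_restart` off the accumulation set, which is `L ⊗ γ^ℕ`-null)
`= ∫ dL(z) ∫ dγ^ℕ(ξs) ∫ dγ^ℕ(ηs) F(Λ_s(z;ξs), Λ_h(Λ_s(z;ξs); ηs))` (fresh-tail / strong Markov
identity with `H(w, ηs) := F(w, Λ_h(w; ηs))`)
`= ∫ F(q, Λ_h(q; ηs)) d(((L ⊗ γ^ℕ) ∘ Λ_s⁻¹) ⊗ γ^ℕ)(q, ηs)` (undo `lintegral_prod`, `lintegral_map`,
`lintegral_prod`).
On `𝕋³` the three standing inputs are: joint measurability of `Λ_t`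
(`measurable_lambertFlow_torus`), `liouville ⊗ γ^ℕ`-a.e. non-accumulation of the collision
instants (`…SwapGapLiouvilleInvarianceLambda.nonAccumulationLambda`, transported to `P ⊗ γ^ℕ` by
`P ≪ liouville`, `Measure.AbsolutelyContinuous.prod`) and the fresh-tail identity
(`…LambertianEulerFreshTail.lambertFlow_freshTail`, torus regularity
`Torus.isHardSphereRegular_geometry` for `ε < 1/2`).

References: pure measure theory on top of the landed Λ-Liouville theorem; the Markov property in
law of a piecewise-deterministic process driven by i.i.d. redraws is [folklore]
(cf. Gallagher–Saint-Raymond–Texier 2013, Ch. 4, for the hard-sphere bookkeeping).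
-/

noncomputable section

namespace Summit.AtomisticToContinuum.HydrodynamicLimit.Theorems.LambertianContactSwapLambertianEulerTwoTimeLaw

open scoped BigOperators Topology ENNReal InnerProductSpace
open MeasureTheory ProbabilityTheory Filter Set InformationTheory
open Literature.MathematicalPhysics.KineticTheory
open Literature.Analysis.FluidPDE Literature.Analysis.FluidPDE.Alexander
open Summit.AtomisticToContinuum.HydrodynamicLimit.Theorems.LambertianContactSwapLambertianEulerLiouvilleOfWindow
open Summit.AtomisticToContinuum.HydrodynamicLimit.Theorems.LambertianContactSwapLambertianEulerFreshTail
open Summit.AtomisticToContinuum.HydrodynamicLimit.Theorems.LambertianContactSwapSwapGapLiouvilleInvarianceLambda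

/-! ## The two-time law, any geometry and any initial measure -/

section Step

variable {d : Type*} [Fintype d] {X : Type*} [MeasurableSpace X] {N : ℕ} {G : Geometry d X} {ε : ℝ}

/-- **Two-time law of the annealed Lambertian flow** (any geometry, any initial measure `L` on
phase space): granted joint measurability of every `Λ_t`, `L ⊗ γ^ℕ`-a.e. non-accumulation of the
collision instants and the fresh-tail identity (for fixed `z`, the noise shifted by `K_t` is again
`γ^ℕ` and independent of `Λ_t(z; ·)`, in `lintegral` form), for `s, h ≥ 0` and measurable `F ≥ 0`
on pairs of states, `∫ F(Λ_s, Λ_{s+h}) d(L ⊗ γ^ℕ) = ∫ F(q, Λ_h(q; ηs)) d(((L ⊗ γ^ℕ) ∘ Λ_s⁻¹) ⊗ γ^ℕ)`: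
the joint law of `(Λ_s, Λ_{s+h})` is that of `(q, Λ_h(q; ηs))` run with fresh noise from the law of
`Λ_s`. [folklore] -/
theorem lintegral_twoTime_eq (L : Measure (Config N d X)) {s h : ℝ} (hs : 0 ≤ s) (hh : 0 ≤ h)
    (hmeas : ∀ t : ℝ, Measurable fun p : Config N d X × (ℕ → EuclideanSpace ℝ d) =>
      lambertFlow G ε p.2 p.1 t)
    (hacc : ∀ᵐ p ∂(L.prod (lambertNoise d)),
      ∀ T : ℝ, ∃ k, ENNReal.ofReal T < lambertInstant G ε p.2 p.1 k)
    (hfresh : ∀ {H : Config N d X × (ℕ → EuclideanSpace ℝ d) → ℝ≥0∞}, Measurable H →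
      ∀ (z : Config N d X) (t : ℝ), 0 ≤ t →
        (∀ᵐ ξs ∂(lambertNoise d), ∃ k, ENNReal.ofReal t < lambertInstant G ε ξs z k) →
        ∫⁻ ξs, H (lambertFlow G ε ξs z t, fun n => ξs (n + lambertCount G ε ξs z t))
            ∂(lambertNoise d) =
          ∫⁻ ξs, (∫⁻ ηs, H (lambertFlow G ε ξs z t, ηs) ∂(lambertNoise d)) ∂(lambertNoise d))
    {F : Config N d X × Config N d X → ℝ≥0∞} (hF : Measurable F) :
    ∫⁻ p, F (lambertFlow G ε p.2 p.1 s, lambertFlow G ε p.2 p.1 (s + h))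
        ∂(L.prod (lambertNoise d)) =
      ∫⁻ q, F (q.1, lambertFlow G ε q.2 q.1 h)
        ∂(((L.prod (lambertNoise d)).map (fun p => lambertFlow G ε p.2 p.1 s)).prod
          (lambertNoise d)) := by
  have hFh : Measurable fun q : Config N d X × (ℕ → EuclideanSpace ℝ d) =>
      F (q.1, lambertFlow G ε q.2 q.1 h) := hF.comp (measurable_fst.prodMk (hmeas h))
  have hΦ : Measurable fun w : Config N d X =>
      ∫⁻ ηs, F (w, lambertFlow G ε ηs w h) ∂(lambertNoise d) :=
    hFh.lintegral_prod_right'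
  have hacc' : ∀ᵐ z ∂L, ∀ᵐ ξs ∂(lambertNoise d),
      ∀ T : ℝ, ∃ k, ENNReal.ofReal T < lambertInstant G ε ξs z k :=
    Measure.ae_ae_of_ae_prod hacc
  calc ∫⁻ p, F (lambertFlow G ε p.2 p.1 s, lambertFlow G ε p.2 p.1 (s + h))
        ∂(L.prod (lambertNoise d))
      = ∫⁻ z, (∫⁻ ξs, F (lambertFlow G ε ξs z s, lambertFlow G ε ξs z (s + h))
          ∂(lambertNoise d)) ∂L :=
        lintegral_prod _ (hF.comp ((hmeas s).prodMk (hmeas (s + h)))).aemeasurable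
    _ = ∫⁻ z, (∫⁻ ξs, (∫⁻ ηs, F (lambertFlow G ε ξs z s,
          lambertFlow G ε ηs (lambertFlow G ε ξs z s) h) ∂(lambertNoise d))
          ∂(lambertNoise d)) ∂L := by
        refine lintegral_congr_ae (hacc'.mono fun z hz => ?_)
        have hzS : ∀ᵐ ξs ∂(lambertNoise d), ∃ k, ENNReal.ofReal s < lambertInstant G ε ξs z k :=
          hz.mono fun ξs hξ => hξ s
        have key : ∫⁻ ξs, F (lambertFlow G ε ξs z s,
              lambertFlow G ε (fun n => ξs (n + lambertCount G ε ξs z s))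
                (lambertFlow G ε ξs z s) h) ∂(lambertNoise d) =
            ∫⁻ ξs, (∫⁻ ηs, F (lambertFlow G ε ξs z s,
              lambertFlow G ε ηs (lambertFlow G ε ξs z s) h) ∂(lambertNoise d))
              ∂(lambertNoise d) :=
          hfresh hFh z s hs hzS
        refine Eq.trans ?_ key
        refine lintegral_congr_ae (hz.mono fun ξs hξ => ?_)
        show F (lambertFlow G ε ξs z s, lambertFlow G ε ξs z (s + h)) =
          F (lambertFlow G ε ξs z s, lambertFlow G ε
            (fun n => ξs (n + lambertCount G ε ξs z s)) (lambertFlow G ε ξs z s) h)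
        rw [lambertFlow_add_eq_restart (ξs := ξs) (z := z) hs hh (hξ s) (hξ (s + h))]
    _ = ∫⁻ p, (∫⁻ ηs, F (lambertFlow G ε p.2 p.1 s,
          lambertFlow G ε ηs (lambertFlow G ε p.2 p.1 s) h) ∂(lambertNoise d))
          ∂(L.prod (lambertNoise d)) :=
        (lintegral_prod _ (hΦ.comp (hmeas s)).aemeasurable).symm
    _ = ∫⁻ w, (∫⁻ ηs, F (w, lambertFlow G ε ηs w h) ∂(lambertNoise d))
          ∂(L.prod (lambertNoise d)).map (fun p => lambertFlow G ε p.2 p.1 s) :=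
        (lintegral_map hΦ (hmeas s)).symm
    _ = ∫⁻ q, F (q.1, lambertFlow G ε q.2 q.1 h)
          ∂(((L.prod (lambertNoise d)).map (fun p => lambertFlow G ε p.2 p.1 s)).prod
            (lambertNoise d)) :=
        (lintegral_prod _ hFh.aemeasurable).symm

end Step

/-! ## The registered stub -/

/-- **Registered stub `stub_twoTimeLawLambda` of line `Sketch`** (crux
`LambertianContactSwap.LambertianEuler`, stmt-AtomisticToContinuum-11854): the two-time law of the
Lambertian hard-sphere gas on `𝕋³` (Markov property in law at a deterministic time).  For
`0 < ε < 1/2`, a finite initial law `P ≪ liouville`, `s, h ≥ 0` and measurable `F ≥ 0` on pairs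
of states, `E_{P ⊗ γ^ℕ}[F(Λ_s, Λ_{s+h})] = E_{μ_s ⊗ γ^ℕ}[F(q, Λ_h(q; ηs))]` with
`μ_s = (P ⊗ γ^ℕ) ∘ Λ_s⁻¹`.  Instance of `lintegral_twoTime_eq` on the torus: measurability
`measurable_lambertFlow_torus`, a.e. non-accumulation `nonAccumulationLambda` transported along
`P ≪ liouville`, fresh tail `lambertFlow_freshTail`. [folklore] -/
theorem stub_twoTimeLawLambda :
    ∀ {ε : ℝ}, 0 < ε → ε < 2⁻¹ → ∀ (N : ℕ) (P : Measure (Config N (Fin 3) T3)) [IsFiniteMeasure P],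
      P ≪ liouville (Torus.geometry (Fin 3)) N ε →
      ∀ (s h : ℝ), 0 ≤ s → 0 ≤ h →
      ∀ {F : Config N (Fin 3) T3 × Config N (Fin 3) T3 → ℝ≥0∞}, Measurable F →
        ∫⁻ p, F (lambertFlow (Torus.geometry (Fin 3)) ε p.2 p.1 s,
            lambertFlow (Torus.geometry (Fin 3)) ε p.2 p.1 (s + h)) ∂(P.prod (lambertNoise (Fin 3))) =
        ∫⁻ q, F (q.1, lambertFlow (Torus.geometry (Fin 3)) ε q.2 q.1 h)
            ∂(((P.prod (lambertNoise (Fin 3))).map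
                (fun p => lambertFlow (Torus.geometry (Fin 3)) ε p.2 p.1 s)).prod (lambertNoise (Fin 3))) := by
  intro ε hε hε' N P _ hP s h hs hh F hF
  have hG : (Torus.geometry (Fin 3)).IsHardSphereRegular ε := Torus.isHardSphereRegular_geometry hε'
  have hGm : (Torus.geometry (Fin 3)).IsMeasurable := Torus.isMeasurable_geometry
  have hAC : P.prod (lambertNoise (Fin 3)) ≪
      (liouville (Torus.geometry (Fin 3)) N ε).prod (lambertNoise (Fin 3)) :=
    hP.prod Measure.AbsolutelyContinuous.rfl
  have hacc : ∀ᵐ p ∂(P.prod (lambertNoise (Fin 3))), ∀ T : ℝ, ∃ k,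
      ENNReal.ofReal T < lambertInstant (Torus.geometry (Fin 3)) ε p.2 p.1 k :=
    hAC.ae_le (nonAccumulationLambda ε hε hε' N)
  exact lintegral_twoTime_eq P hs hh (measurable_lambertFlow_torus hε') hacc
    (fun hH z t ht hgood => lambertFlow_freshTail hG hGm hH z t ht hgood) hF

end Summit.AtomisticToContinuum.HydrodynamicLimit.Theorems.LambertianContactSwapLambertianEulerTwoTimeLaw

end
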